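import Literature.AlgebraicGeometry.Resolution.PointBlowupIntersectionMultiplicityFinite
import Literature.AlgebraicGeometry.Resolution.SubschemeRegularStalks
import Literature.AlgebraicGeometry.Resolution.RegularCentreRsopPart
import HarnessLib

/-!
# On a regular curve transverse to a regular centre, the centre cuts out an effective Cartier divisor
# (CoP1, proof of Prop. 4.4, p. 10: "under assumption (4) in lemma 4.3")

Topic: `Literature/AlgebraicGeometry/Resolution`. [CoP1] = Cossart–Piltant, J. Algebra 320 (2008)
1051–1082, proof of Prop. 4.4, p. 10: at a curve step the centre `Y` is a regular irreducible curve of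
`Σ = {ord = μ}` and, "under assumption (4) in lemma 4.3", the other one-dimensional components `C` of `Σ` are
regular and meet `Y` transversally; then "the strict transform of `Σ` in `X′` is transverse to the exceptional
divisor". The first step of that remark, in the language of Stacks Lemma 54.15.3 (Tag 0BI7, proof: "we can
pick an element `x₁ ∈ 𝔪_p` mapping to a uniformizer in `𝒪_{Y,p}` … `p` is an effective Cartier divisor on
`Y`"), is PROVED here, for the reduced closed subscheme `V(𝓘_C)` on a closed subset `C` of a locally
Noetherian scheme `X` whose reduced ideal is generated at each point of `C` by a PAIR of elements of a regular
system of parameters, transverse (`𝓘_{C,x} + 𝓘_{Y,x} = 𝔪_x`) to a closed subset `Y` at the points of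
`C ∩ Y`, which are threefold points (`dim 𝒪_{X,x} = 3`):

* `isRegular_subscheme_vanishingIdeal_of_forall_isRsopPart` — `V(𝓘_C)` is a regular scheme;
* `ringKrullDim_quotient_span_pair_eq_one` — `dim 𝒪_{X,x}/(c₁, c₂) = 1`;
* `isEffectiveCartier_comap_subschemeι_of_transverse` — **`𝓘_Y 𝒪_C` is an effective Cartier divisor
  on `V(𝓘_C)`**: at `v` over `x ∈ C ∩ Y`, `𝒪_{C,v} = 𝒪_{X,x}/𝓘_{C,x}` is a discrete valuation ring and
  `𝓘_Y 𝒪_{C,v} = (𝓘_{C,x} + 𝓘_{Y,x})/𝓘_{C,x} = 𝔪_{C,v} = (t)`, `t ≠ 0`.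

Consumed by `StrictTransformTransverseCurve.lean` (the strict transform of `C` under the blowing up along
`Y` is `Bl_{𝓘_Y 𝒪_C} C ≅ C`, Stacks 080E/0807). Cell res-hironaka, F-71 census brick T2c
(`plan/inputs/F71-CENSUS-v2.md`). No definitions, no named facts.

## Sources

* V. Cossart, O. Piltant, J. Algebra 320 (2008) 1051–1082, proof of Prop. 4.4, p. 10. [CossartPiltant2008]
* The Stacks Project, Tag 0BI7 (Lemma 54.15.3, proof, first step). [StacksProject]
* H. Matsumura, *Commutative Ring Theory* (1986), Thm. 14.2. [Matsumura1987]
-/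

noncomputable section

open CategoryTheory CategoryTheory.Limits AlgebraicGeometry TopologicalSpace IsLocalRing

namespace Literature.AlgebraicGeometry.Resolution

universe u

open Scheme.IdealSheafData

variable {X : Scheme.{u}}

/-! ## A closed subset cut out pointwise by parts of regular systems of parameters is a regular subscheme -/

/-- **A closed subset whose reduced ideal is generated, at each of its points, by part of a regular system of
parameters carries a regular reduced subscheme structure** (Matsumura 14.2: `𝒪_{X,x}/(z₁,…,z_r)` is regular).
[cite: Matsumura1987, Thm. 14.2] -/
theorem isRegular_subscheme_vanishingIdeal_of_forall_isRsopPart [IsLocallyNoetherian X] {C : Closeds X}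
    (hCreg : ∀ x ∈ (C : Set X), ∃ (r : ℕ) (c : Fin r → X.presheaf.stalk x),
      IsRsopPart c ∧ Ideal.span (Set.range c) = stalkIdeal (vanishingIdeal C) x) :
    Scheme.IsRegular (vanishingIdeal C).subscheme := by
  refine Scheme.isRegular_subscheme_of_forall _ fun x hx => ?_
  have hxC : x ∈ (C : Set X) := by
    rw [← coe_support_vanishingIdeal C]; exact hx
  obtain ⟨r, c, hc, hspan⟩ := hCreg x hxC
  rw [← hspan]
  exact hc.isRegularLocalRing_quotient


/-! ## On a transverse regular curve the regular centre cuts out an effective Cartier divisor -/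

/-- From `dim R/(c₁, c₂) + 2 = dim R = 3` for a pair `c` of regular parameters: `dim R/(c₁, c₂) = 1`.
[cite: Matsumura1987, Thm. 14.2] -/
theorem ringKrullDim_quotient_span_pair_eq_one {R : Type u} [CommRing R] [IsLocalRing R] {c : Fin 2 → R}
    (hc : IsRsopPart c) (h3 : ringKrullDim R = 3) :
    ringKrullDim (R ⧸ Ideal.span (Set.range c)) = 1 := by
  haveI := hc.isRegularLocalRing
  haveI : IsRegularLocalRing (R ⧸ Ideal.span (Set.range c)) := hc.isRegularLocalRing_quotient
  have h := hc.ringKrullDim_quotient_add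
  obtain ⟨k, hk⟩ := exists_nat_cast_eq_ringKrullDim (R := R ⧸ Ideal.span (Set.range c))
  rw [hk, h3] at h
  have hk2 : k + 2 = 3 := by exact_mod_cast h
  have hk1 : k = 1 := by omega
  rw [hk, hk1]; rfl

/-- **On a regular curve `C` transverse to the regular centre `Y` at threefold points, the ideal of `Y`
restricts to an effective Cartier divisor of `C`** (with its reduced structure): at `v ∈ C ∩ Y` the local
ring `𝒪_{C,v} = 𝒪_{X,v}/𝓘_{C,v}` is a discrete valuation ring and `𝓘_Y 𝒪_{C,v} = (𝓘_C + 𝓘_Y)/𝓘_C = 𝔪_{C,v}`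
is generated by a uniformizer (CoP1, p. 10: under assumption (4) of Lemma 4.3 — `Σ` a curve meeting the
curve centre transversally — the blowing up does not change `Σ`). [cite: CossartPiltant2008, Prop. 4.4 (proof, p. 10)]
[cite: StacksProject, Tag 0BI7 (Lemma 54.15.3, proof, first step)] -/
theorem isEffectiveCartier_comap_subschemeι_of_transverse [IsLocallyNoetherian X] {Y C : Closeds X}
    (hCreg : ∀ x ∈ (C : Set X), ∃ c : Fin 2 → X.presheaf.stalk x,
      IsRsopPart c ∧ Ideal.span (Set.range c) = stalkIdeal (vanishingIdeal C) x)
    (htr : ∀ x ∈ (C : Set X) ∩ Y,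
      stalkIdeal (vanishingIdeal C) x ⊔ stalkIdeal (vanishingIdeal Y) x = maximalIdeal _)
    (hdim : ∀ x ∈ (C : Set X) ∩ Y, ringKrullDim (X.presheaf.stalk x) = 3) :
    IsEffectiveCartier ((vanishingIdeal Y).comap (vanishingIdeal C).subschemeι) := by
  haveI : IsLocallyNoetherian (vanishingIdeal C).subscheme :=
    LocallyOfFiniteType.isLocallyNoetherian (vanishingIdeal C).subschemeι
  refine isEffectiveCartier_of_forall_mem_nonZeroDivisors fun v hv => ?_
  have hxY : (vanishingIdeal C).subschemeι v ∈ (Y : Set X) := by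
    have h1 : v ∈ ((((vanishingIdeal Y).comap (vanishingIdeal C).subschemeι).support :
        Set (vanishingIdeal C).subscheme)) := hv
    rw [support_comap, Closeds.coe_preimage, coe_support_vanishingIdeal] at h1
    exact h1
  have hxC : (vanishingIdeal C).subschemeι v ∈ (C : Set X) := by
    have h1 : (vanishingIdeal C).subschemeι v ∈ Set.range (vanishingIdeal C).subschemeι :=
      Set.mem_range_self v
    rw [range_subschemeι] at h1
    rw [← coe_support_vanishingIdeal C]
    exact h1
  obtain ⟨c, hc, hspan⟩ := hCreg _ hxC
  -- `𝒪_{C,v} = 𝒪_{X,v} / 𝓘_{C,v}` is a regular local ring of dimension `1`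
  have hsurj : Function.Surjective ((vanishingIdeal C).subschemeι.stalkMap v).hom :=
    (vanishingIdeal C).subschemeι.stalkMap_surjective v
  have hker : RingHom.ker ((vanishingIdeal C).subschemeι.stalkMap v).hom = Ideal.span (Set.range c) := by
    have h := stalkIdeal_ker_eq_ker_stalkMap (vanishingIdeal C).subschemeι v
    rw [ker_subschemeι] at h
    rw [← h, hspan]
  let e : (X.presheaf.stalk ((vanishingIdeal C).subschemeι v) ⧸ Ideal.span (Set.range c)) ≃+*
      (vanishingIdeal C).subscheme.presheaf.stalk v :=
    (Ideal.quotEquivOfEq hker.symm).trans (RingHom.quotientKerEquivOfSurjective hsurj)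
  haveI : IsRegularLocalRing (X.presheaf.stalk ((vanishingIdeal C).subschemeι v) ⧸
      Ideal.span (Set.range c)) :=
    hc.isRegularLocalRing_quotient
  haveI hregv : IsRegularLocalRing ((vanishingIdeal C).subscheme.presheaf.stalk v) :=
    IsRegularLocalRing.of_ringEquiv e
  have hdimv : ringKrullDim ((vanishingIdeal C).subscheme.presheaf.stalk v) = 1 := by
    rw [← ringKrullDim_eq_of_ringEquiv e]
    exact ringKrullDim_quotient_span_pair_eq_one hc (hdim _ ⟨hxC, hxY⟩)
  haveI : IsPrincipalIdealRing ((vanishingIdeal C).subscheme.presheaf.stalk v) :=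
    isPrincipalIdealRing_of_ringKrullDim_le_one hdimv.le
  haveI := isDomain_of_isRegularLocalRing ((vanishingIdeal C).subscheme.presheaf.stalk v)
  obtain ⟨t, ht⟩ :=
    (IsPrincipalIdealRing.principal (maximalIdeal ((vanishingIdeal C).subscheme.presheaf.stalk v))).principal
  have ht0 : t ≠ 0 := by
    rintro rfl
    have hbot : maximalIdeal ((vanishingIdeal C).subscheme.presheaf.stalk v) = ⊥ := by
      rw [ht]; simp
    have hf : IsField ((vanishingIdeal C).subscheme.presheaf.stalk v) :=
      (IsLocalRing.isField_iff_maximalIdeal_eq).mpr hbot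
    have h0 := ringKrullDim_eq_zero_of_isField hf
    rw [hdimv] at h0
    exact absurd h0 (by decide)
  refine ⟨t, mem_nonZeroDivisors_of_ne_zero ht0, ?_⟩
  -- `𝓘_Y 𝒪_{C,v} = (𝓘_C + 𝓘_Y) 𝒪_{C,v} = 𝔪 𝒪_{C,v} = 𝔪_{C,v} = (t)`
  have hPbot : (stalkIdeal (vanishingIdeal C) ((vanishingIdeal C).subschemeι v)).map
      ((vanishingIdeal C).subschemeι.stalkMap v).hom = ⊥ := by
    rw [← hspan, ← hker, Ideal.map_eq_bot_iff_le_ker]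
  rw [stalkIdeal_comap_eq_map_stalkMap,
    ← bot_sup_eq ((stalkIdeal (vanishingIdeal Y) ((vanishingIdeal C).subschemeι v)).map _),
    ← hPbot, ← Ideal.map_sup, htr _ ⟨hxC, hxY⟩, IsLocalRing.map_maximalIdeal_of_surjective _ hsurj, ht]


end Literature.AlgebraicGeometry.Resolution

end
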